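import Summits.CriticalPhenomena.CardyFormulaZ2.Theorems.CardyIKTransportIKLinearTransportWallDominationDefs

/-!
# `CardyIKTransport.IKLinearTransport` (stmt-CriticalPhenomena-5076), line `pinned-diagram-exchange`, lead c8 —
# WALL DOMINATION, the two-sided composition `stub_twoWallOfOne : OneWallDomination → ProductStructure → RotInvariance → TwoWallDomination`

Support file (`--supports stmt-CriticalPhenomena-5076`, registered sub-goal `stub_twoWallOfOne`).

THE ARGUMENT (no layer cake is needed: the inner conditional probabilities are themselves sums of indicators).  Write
`N_τ(E) = Σ_x [x ∈ E] W_τ(x)`.  By the product structure, `N_τ(E) = Σ_a Σ_b [a, b agree on the middle column] [join a b ∈ E] W₁(a) W₂(b)`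
(left parts `a`, face types `τL τ`; right parts `b`, face types `τR τ`).  For a fixed left part `a` the inner sum is `N_{τR}(F_a)` for the
event `F_a = {b | wallCol b = last column of a ∧ join a b ∈ E}` of the RIGHT slab, which is wall-monotone when `E` is two-wall-monotone
(`wallMonotone_fibreR`); one-wall domination and the wall-sum identity give `N_{τR}(F_a) / C(τR) ≥ N_{hon}(F_a) / C(hon)` (`num_div_le_of_wallMonotone`).
Swapping the two sums, for a fixed right part `b` the inner sum is `N_{τL}(G_b)` for the LAST-wall-monotone event
`G_b = {a | last column of a = wallCol b ∧ join a b ∈ E}` of the left slab (`lastWallMonotone_fibreL`), and the rotation by `π` turns the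
one-wall domination into `N_{τL}(G_b) / C(τL) ≥ N_{hon}(G_b) / C(hon)` (`num_div_le_of_lastWallMonotone`).  Unswapping,
`N_τ(E) ≥ (C(τL) C(τR) / C(hon)²) · N_hon(E)`, and the partition functions are `cylZ = 2^L · C(τL) · C(τR)` (`cylZ_eq_card_mul`,
`Fin.prod_univ_add`), whence `cylProb hon E ≤ cylProb τ E` (`final_ineq`).
-/

noncomputable section

namespace Summit.CriticalPhenomena.CardyFormulaZ2.Theorems.IKLinearTransport.PinnedDiagramExchange.WallDomination

open scoped BigOperators Classical
open Finset
open Summit.CriticalPhenomena.CardyFormulaZ2.Cruxes.IKMixedBoxCrossing.DefectClosureExploration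
open CylBunchStub (resLE resLast splitEquiv colConst)

namespace TwoWallStub

variable {w L : ℕ}

/-! ## §1 Partition functions and the conditional form of one-wall domination -/

/-- The product of the column constants of a slab is positive. -/
theorem prod_colConst_pos [NeZero L] (τ : Fin w → Bool) : 0 < ∏ j, colConst (τ j) L :=
  Finset.prod_pos fun j _ => CylBunchStub.colConst_pos (τ j) L

/-- THE PARTITION FUNCTION from the wall-sum identity: `cylZ = #(wall colourings) · ∏ column constants`. -/
theorem cylZ_eq_card_mul [NeZero L]
    (hwall : ∀ (w L : ℕ) [NeZero L] (τ : Fin w → Bool) (ξ : ZMod L → Bool),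
      (∑ x : CylCfg w L, if wallCol x = ξ then cylWeight w L τ x else 0) = ∏ j, colConst (τ j) L)
    (τ : Fin w → Bool) : cylZ w L τ = (Fintype.card (ZMod L → Bool) : ℝ) * ∏ j, colConst (τ j) L := by
  unfold cylZ
  have h1 : ∀ x : CylCfg w L, cylWeight w L τ x = ∑ ξ : ZMod L → Bool, if wallCol x = ξ then cylWeight w L τ x else 0 :=
    fun x => by rw [Finset.sum_ite_eq, if_pos (Finset.mem_univ _)]
  calc ∑ x : CylCfg w L, cylWeight w L τ x
      = ∑ x : CylCfg w L, ∑ ξ : ZMod L → Bool, if wallCol x = ξ then cylWeight w L τ x else 0 :=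
        Finset.sum_congr rfl fun x _ => h1 x
    _ = ∑ ξ : ZMod L → Bool, ∑ x : CylCfg w L, if wallCol x = ξ then cylWeight w L τ x else 0 := Finset.sum_comm
    _ = ∑ _ξ : ZMod L → Bool, ∏ j, colConst (τ j) L := Finset.sum_congr rfl fun ξ _ => hwall w L τ ξ
    _ = (Fintype.card (ZMod L → Bool) : ℝ) * ∏ j, colConst (τ j) L := by
        rw [Finset.sum_const, nsmul_eq_mul, Finset.card_univ]

/-- From `N / (K · C) ≤ N' / (K · C')` with `K > 0` to `N / C ≤ N' / C'`. -/
theorem div_le_div_of_mul {N N' K C C' : ℝ} (hK : 0 < K) (hC : 0 < C) (hC' : 0 < C')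
    (h : N / (K * C) ≤ N' / (K * C')) : N / C ≤ N' / C' := by
  rw [div_le_div_iff₀ (mul_pos hK hC) (mul_pos hK hC')] at h
  rw [div_le_div_iff₀ hC hC']
  nlinarith [h]

/-- ONE-WALL DOMINATION IN NUMERATOR FORM: for a wall-monotone event `F`, `N_hon(F) / C(hon) ≤ N_τ(F) / C(τ)`.  (Applied to events already cut
down to one wall colouring this is the CONDITIONAL domination given the wall.) -/
theorem num_div_le_of_wallMonotone [NeZero L] (hOne : OneWallDomination)
    (hwall : ∀ (w L : ℕ) [NeZero L] (τ : Fin w → Bool) (ξ : ZMod L → Bool),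
      (∑ x : CylCfg w L, if wallCol x = ξ then cylWeight w L τ x else 0) = ∏ j, colConst (τ j) L)
    (hL : 3 ≤ L) (τ : Fin w → Bool) {F : Set (CylCfg w L)} (hF : WallMonotone F) :
    (∑ x, if x ∈ F then cylWeight w L (fun _ => false) x else 0) / (∏ _j : Fin w, colConst false L) ≤
      (∑ x, if x ∈ F then cylWeight w L τ x else 0) / ∏ j, colConst (τ j) L := by
  have h := hOne w L hL τ F hF
  unfold cylProb at h
  rw [cylZ_eq_card_mul hwall, cylZ_eq_card_mul hwall] at h
  have hc : (0 : ℝ) < Fintype.card (ZMod L → Bool) := by exact_mod_cast Fintype.card_pos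
  exact div_le_div_of_mul hc (prod_colConst_pos _) (prod_colConst_pos _) h

/-- ONE-WALL DOMINATION FOR THE LAST WALL (through the rotation by `π`), numerator form: for a last-wall-monotone event `G`,
`N_hon(G) / C(hon) ≤ N_τ(G) / C(τ)`. -/
theorem num_div_le_of_lastWallMonotone [NeZero L] (hOne : OneWallDomination)
    (hwall : ∀ (w L : ℕ) [NeZero L] (τ : Fin w → Bool) (ξ : ZMod L → Bool),
      (∑ x : CylCfg w L, if wallCol x = ξ then cylWeight w L τ x else 0) = ∏ j, colConst (τ j) L)
    (hinv : ∀ (w L : ℕ) (x : CylCfg w L), rotCyl (rotCyl x) = x)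
    (hprob : ∀ (w L : ℕ) [NeZero L] (τ : Fin w → Bool) (E : Set (CylCfg w L)),
      cylProb w L (τ ∘ Fin.rev) (rotCyl ⁻¹' E) = cylProb w L τ E)
    (hmono : ∀ (w L : ℕ) (E : Set (CylCfg w L)), LastWallMonotone E → WallMonotone (rotCyl ⁻¹' E))
    (hL : 3 ≤ L) (τ : Fin w → Bool) {G : Set (CylCfg w L)} (hG : LastWallMonotone G) :
    (∑ x, if x ∈ G then cylWeight w L (fun _ => false) x else 0) / (∏ _j : Fin w, colConst false L) ≤
      (∑ x, if x ∈ G then cylWeight w L τ x else 0) / ∏ j, colConst (τ j) L := by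
  -- `cylProb hon G ≤ cylProb τ G` through the rotation
  have hpre : rotCyl ⁻¹' (rotCyl ⁻¹' G) = G := by
    ext x
    simp only [Set.mem_preimage, hinv]
  have hrev : (τ ∘ Fin.rev) ∘ Fin.rev = τ := by
    funext j
    simp only [Function.comp_apply, Fin.rev_rev]
  have h1 : cylProb w L τ G = cylProb w L (τ ∘ Fin.rev) (rotCyl ⁻¹' G) := by
    rw [← hprob w L (τ ∘ Fin.rev) (rotCyl ⁻¹' G), hrev, hpre]
  have h2 : cylProb w L (fun _ => false) G = cylProb w L (fun _ => false) (rotCyl ⁻¹' G) := by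
    rw [← hprob w L (fun _ => false) (rotCyl ⁻¹' G), hpre]
    rfl
  have h := hOne w L hL (τ ∘ Fin.rev) (rotCyl ⁻¹' G) (hmono w L G hG)
  rw [← h1, ← h2] at h
  unfold cylProb at h
  rw [cylZ_eq_card_mul hwall, cylZ_eq_card_mul hwall] at h
  have hc : (0 : ℝ) < Fintype.card (ZMod L → Bool) := by exact_mod_cast Fintype.card_pos
  exact div_le_div_of_mul hc (prod_colConst_pos _) (prod_colConst_pos _) h

/-! ## §2 The fibres of a two-wall-monotone event are (last-)wall-monotone -/

variable {w₁ w₂ : ℕ}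

/-- The middle column of a join is the last column of its left part. -/
theorem midCol_joinCfg (a : CylCfg w₁ L) (b : CylCfg w₂ L) :
    midCol w₁ w₂ (joinCfg a b) = fun r => a.1 (Fin.last w₁, r) := by
  funext r
  simp only [midCol, joinCfg, le_refl, dite_true]
  rfl

/-- For a fixed LEFT part, the set of right parts agreeing with it on the middle column and joining into `E` is wall-monotone. -/
theorem wallMonotone_fibreR
    (hres : ∀ (w₁ w₂ L : ℕ) (a : CylCfg w₁ L) (b : CylCfg w₂ L), (fun r => a.1 (Fin.last w₁, r)) = wallCol b →
      resLE (Nat.le_add_right w₁ w₂) (joinCfg a b) = a ∧ resGE w₁ w₂ (joinCfg a b) = b)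
    {E : Set (CylCfg (w₁ + w₂) L)} (hE : TwoWallMonotone w₁ w₂ E) (a : CylCfg w₁ L) :
    WallMonotone {b : CylCfg w₂ L | (fun r => a.1 (Fin.last w₁, r)) = wallCol b ∧ joinCfg a b ∈ E} := by
  intro b b' hcol hrel ⟨hagree, hmem⟩
  have hagree' : (fun r => a.1 (Fin.last w₁, r)) = wallCol b' := hagree.trans hcol
  refine ⟨hagree', hE (joinCfg a b) (joinCfg a b') ?_ ?_ ?_ hmem⟩
  · rw [midCol_joinCfg, midCol_joinCfg]
  · intro rs hrs
    simp only [leftRel, Set.mem_setOf_eq] at hrs ⊢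
    rw [(hres w₁ w₂ L a b' hagree').1]
    rwa [(hres w₁ w₂ L a b hagree).1] at hrs
  · intro rs hrs
    simp only [rightRel, wallRel, Set.mem_setOf_eq] at hrs ⊢
    rw [(hres w₁ w₂ L a b' hagree').2]
    rw [(hres w₁ w₂ L a b hagree).2] at hrs
    exact hrel hrs

/-- For a fixed RIGHT part, the set of left parts agreeing with it on the middle column and joining into `E` is last-wall-monotone. -/
theorem lastWallMonotone_fibreL
    (hres : ∀ (w₁ w₂ L : ℕ) (a : CylCfg w₁ L) (b : CylCfg w₂ L), (fun r => a.1 (Fin.last w₁, r)) = wallCol b →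
      resLE (Nat.le_add_right w₁ w₂) (joinCfg a b) = a ∧ resGE w₁ w₂ (joinCfg a b) = b)
    {E : Set (CylCfg (w₁ + w₂) L)} (hE : TwoWallMonotone w₁ w₂ E) (b : CylCfg w₂ L) :
    LastWallMonotone {a : CylCfg w₁ L | (fun r => a.1 (Fin.last w₁, r)) = wallCol b ∧ joinCfg a b ∈ E} := by
  intro a a' hcol hrel ⟨hagree, hmem⟩
  have hagree' : (fun r => a'.1 (Fin.last w₁, r)) = wallCol b := hcol.symm.trans hagree
  refine ⟨hagree', hE (joinCfg a b) (joinCfg a' b) ?_ ?_ ?_ hmem⟩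
  · rw [midCol_joinCfg, midCol_joinCfg]
    exact hcol
  · intro rs hrs
    simp only [leftRel, Set.mem_setOf_eq] at hrs ⊢
    rw [(hres w₁ w₂ L a' b hagree').1]
    rw [(hres w₁ w₂ L a b hagree).1] at hrs
    exact hrel hrs
  · intro rs hrs
    simp only [rightRel, wallRel, Set.mem_setOf_eq] at hrs ⊢
    rw [(hres w₁ w₂ L a' b hagree').2]
    rwa [(hres w₁ w₂ L a b hagree).2] at hrs

/-! ## §3 The numerator over the product structure -/

/-- THE NUMERATOR OF A SLAB PROBABILITY AS A DOUBLE SUM over left and right parts agreeing on the middle column. -/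
theorem num_eq_sum_sum [NeZero L]
    (hsum : ∀ (w₁ w₂ L : ℕ) [NeZero L] (F : CylCfg (w₁ + w₂) L → ℝ),
      ∑ x, F x = ∑ a : CylCfg w₁ L, ∑ b : CylCfg w₂ L,
        if (fun r => a.1 (Fin.last w₁, r)) = wallCol b then F (joinCfg a b) else 0)
    (hwt : ∀ (w₁ w₂ L : ℕ) [NeZero L] (τ : Fin (w₁ + w₂) → Bool) (a : CylCfg w₁ L) (b : CylCfg w₂ L),
      (fun r => a.1 (Fin.last w₁, r)) = wallCol b →
        cylWeight (w₁ + w₂) L τ (joinCfg a b) = cylWeight w₁ L (τL τ) a * cylWeight w₂ L (τR τ) b)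
    (τ : Fin (w₁ + w₂) → Bool) (E : Set (CylCfg (w₁ + w₂) L)) :
    (∑ x, if x ∈ E then cylWeight (w₁ + w₂) L τ x else 0) =
      ∑ a : CylCfg w₁ L, ∑ b : CylCfg w₂ L,
        if b ∈ {b : CylCfg w₂ L | (fun r => a.1 (Fin.last w₁, r)) = wallCol b ∧ joinCfg a b ∈ E}
          then cylWeight w₁ L (τL τ) a * cylWeight w₂ L (τR τ) b else 0 := by
  rw [hsum w₁ w₂ L (fun x => if x ∈ E then cylWeight (w₁ + w₂) L τ x else 0)]
  refine Finset.sum_congr rfl fun a _ => Finset.sum_congr rfl fun b _ => ?_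
  simp only [Set.mem_setOf_eq]
  by_cases hag : (fun r => a.1 (Fin.last w₁, r)) = wallCol b
  · by_cases hmem : joinCfg a b ∈ E
    · rw [if_pos hag, if_pos hmem, if_pos ⟨hag, hmem⟩, hwt w₁ w₂ L τ a b hag]
    · rw [if_pos hag, if_neg hmem, if_neg (fun h => hmem h.2)]
  · rw [if_neg hag, if_neg (fun h => hag h.1)]

/-- Pulling a constant out of an indicator sum (stated for an arbitrary decidable predicate, so that it rewrites under any instance). -/
theorem inner_mul {β : Type*} [Fintype β] (P : β → Prop) [DecidablePred P] (Wa : ℝ) (W : β → ℝ) :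
    (∑ b, if P b then Wa * W b else 0) = Wa * ∑ b, if P b then W b else 0 := by
  rw [Finset.mul_sum]
  refine Finset.sum_congr rfl fun b _ => ?_
  rw [mul_ite, mul_zero]

/-- The same sets of pairs, read by rows or by columns: membership of `b` in the fibre of `a` is membership of `a` in the fibre of `b`. -/
theorem mem_fibre_comm (E : Set (CylCfg (w₁ + w₂) L)) (a : CylCfg w₁ L) (b : CylCfg w₂ L) :
    b ∈ {b : CylCfg w₂ L | (fun r => a.1 (Fin.last w₁, r)) = wallCol b ∧ joinCfg a b ∈ E} ↔
      a ∈ {a : CylCfg w₁ L | (fun r => a.1 (Fin.last w₁, r)) = wallCol b ∧ joinCfg a b ∈ E} := Iff.rfl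

/-- SWAPPING THE DOUBLE SUM: `Σ_a W₁(a) Σ_b [b ∈ F_a] W₂(b) = Σ_b W₂(b) Σ_a [a ∈ G_b] W₁(a)`. -/
theorem swap_sums [NeZero L] (E : Set (CylCfg (w₁ + w₂) L)) (W₁ : CylCfg w₁ L → ℝ) (W₂ : CylCfg w₂ L → ℝ) :
    (∑ a : CylCfg w₁ L, W₁ a * ∑ b : CylCfg w₂ L,
        if b ∈ {b : CylCfg w₂ L | (fun r => a.1 (Fin.last w₁, r)) = wallCol b ∧ joinCfg a b ∈ E} then W₂ b else 0) =
      ∑ b : CylCfg w₂ L, W₂ b * ∑ a : CylCfg w₁ L,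
        if a ∈ {a : CylCfg w₁ L | (fun r => a.1 (Fin.last w₁, r)) = wallCol b ∧ joinCfg a b ∈ E} then W₁ a else 0 := by
  have e1 : (∑ a : CylCfg w₁ L, W₁ a * ∑ b : CylCfg w₂ L,
      if b ∈ {b : CylCfg w₂ L | (fun r => a.1 (Fin.last w₁, r)) = wallCol b ∧ joinCfg a b ∈ E} then W₂ b else 0) =
      ∑ a : CylCfg w₁ L, ∑ b : CylCfg w₂ L,
        if b ∈ {b : CylCfg w₂ L | (fun r => a.1 (Fin.last w₁, r)) = wallCol b ∧ joinCfg a b ∈ E} then W₁ a * W₂ b else 0 := by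
    refine Finset.sum_congr rfl fun a _ => ?_
    rw [Finset.mul_sum]
    exact Finset.sum_congr rfl fun b _ => by rw [mul_ite, mul_zero]
  have e2 : (∑ b : CylCfg w₂ L, W₂ b * ∑ a : CylCfg w₁ L,
      if a ∈ {a : CylCfg w₁ L | (fun r => a.1 (Fin.last w₁, r)) = wallCol b ∧ joinCfg a b ∈ E} then W₁ a else 0) =
      ∑ b : CylCfg w₂ L, ∑ a : CylCfg w₁ L,
        if b ∈ {b : CylCfg w₂ L | (fun r => a.1 (Fin.last w₁, r)) = wallCol b ∧ joinCfg a b ∈ E} then W₁ a * W₂ b else 0 := by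
    refine Finset.sum_congr rfl fun b _ => ?_
    rw [Finset.mul_sum]
    refine Finset.sum_congr rfl fun a _ => ?_
    rw [mul_ite, mul_zero, mul_comm]
    exact if_congr (mem_fibre_comm E a b).symm rfl rfl
  rw [e1, e2, Finset.sum_comm]

/-! ## §4 The real-arithmetic endgame -/

/-- From the two fibrewise dominations to the comparison of the probabilities. -/
theorem final_ineq {Nτ Nh X C₁ C₂ D₁ D₂ K : ℝ} (hC₁ : 0 < C₁) (hC₂ : 0 < C₂) (hD₁ : 0 < D₁) (hD₂ : 0 < D₂) (hK : 0 < K)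
    (hNh : 0 ≤ Nh) (h1 : C₂ / D₂ * X ≤ Nτ) (h2 : C₁ / D₁ * Nh ≤ X) :
    Nh / (K * (D₁ * D₂)) ≤ Nτ / (K * (C₁ * C₂)) := by
  have h3 : C₂ / D₂ * (C₁ / D₁ * Nh) ≤ Nτ := (mul_le_mul_of_nonneg_left h2 (div_nonneg hC₂.le hD₂.le)).trans h1
  have e : C₂ / D₂ * (C₁ / D₁ * Nh) = Nh * (C₁ * C₂) / (D₁ * D₂) := by
    field_simp
  rw [e, div_le_iff₀ (mul_pos hD₁ hD₂)] at h3
  rw [div_le_div_iff₀ (by positivity) (by positivity)]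
  have _ := hNh
  nlinarith [h3, hK]

end TwoWallStub

open TwoWallStub in
/-- **Registered sub-goal `stub_twoWallOfOne`** (line `pinned-diagram-exchange`, lead c8): the two-sided composition
`OneWallDomination → ProductStructure → RotInvariance → TwoWallDomination` — iterated sums over the product structure, one-wall
domination on the right part fibre by fibre, the rotated one-wall domination on the left part fibre by fibre. -/
theorem stub_twoWallOfOne : TwoWallOfOne := by
  intro hOne hPS hRot w₁ w₂ L _ hL τ E hE
  obtain ⟨hsum, hwt, hres, hwall⟩ := hPS
  obtain ⟨hinv, -, -, hprob, hmono⟩ := hRot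
  have hcard : (0 : ℝ) < Fintype.card (ZMod L → Bool) := by exact_mod_cast Fintype.card_pos
  -- partition functions
  have hZτ : cylZ (w₁ + w₂) L τ =
      Fintype.card (ZMod L → Bool) * ((∏ j, colConst (τL τ j) L) * ∏ j, colConst (τR τ j) L) := by
    rw [cylZ_eq_card_mul hwall, Fin.prod_univ_add]
    rfl
  have hZh : cylZ (w₁ + w₂) L (fun _ => false) =
      Fintype.card (ZMod L → Bool) * ((∏ _j : Fin w₁, colConst false L) * ∏ _j : Fin w₂, colConst false L) := by
    rw [cylZ_eq_card_mul hwall, Fin.prod_univ_add]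
  -- STEP 1 (right fibres): `(C₂ / D₂) · Σ_a W₁^τ(a) Σ_b [b ∈ F_a] W₂^hon(b) ≤ N_τ(E)`
  have step1 : (∏ j, colConst (τR τ j) L) / (∏ _j : Fin w₂, colConst false L) *
      ∑ a : CylCfg w₁ L, cylWeight w₁ L (τL τ) a * ∑ b : CylCfg w₂ L,
        (if b ∈ {b : CylCfg w₂ L | (fun r => a.1 (Fin.last w₁, r)) = wallCol b ∧ joinCfg a b ∈ E}
          then cylWeight w₂ L (fun _ => false) b else 0) ≤
      ∑ x, if x ∈ E then cylWeight (w₁ + w₂) L τ x else 0 := by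
    rw [num_eq_sum_sum hsum hwt τ E, Finset.mul_sum]
    refine Finset.sum_le_sum fun a _ => ?_
    rw [inner_mul]
    have key := num_div_le_of_wallMonotone hOne hwall hL (τR τ) (wallMonotone_fibreR (L := L) hres hE a)
    rw [div_le_div_iff₀ (prod_colConst_pos (L := L) fun _ : Fin w₂ => false) (prod_colConst_pos _)] at key
    have hWa : 0 ≤ cylWeight w₁ L (τL τ) a := CylBunchStub.cylWeight_nonneg _ _ _ _
    rw [← mul_assoc, mul_comm (_ / _) (cylWeight w₁ L (τL τ) a), mul_assoc]
    refine mul_le_mul_of_nonneg_left ?_ hWa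
    rw [div_mul_eq_mul_div, div_le_iff₀ (prod_colConst_pos (L := L) fun _ : Fin w₂ => false), mul_comm]
    convert key using 4
  -- STEP 2 (left fibres, after swapping the sums): `(C₁ / D₁) · N_hon(E) ≤ Σ_a W₁^τ(a) Σ_b [b ∈ F_a] W₂^hon(b)`
  have step2 : (∏ j, colConst (τL τ j) L) / (∏ _j : Fin w₁, colConst false L) *
      (∑ x, if x ∈ E then cylWeight (w₁ + w₂) L (fun _ => false) x else 0) ≤
      ∑ a : CylCfg w₁ L, cylWeight w₁ L (τL τ) a * ∑ b : CylCfg w₂ L,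
        (if b ∈ {b : CylCfg w₂ L | (fun r => a.1 (Fin.last w₁, r)) = wallCol b ∧ joinCfg a b ∈ E}
          then cylWeight w₂ L (fun _ => false) b else 0) := by
    have eh : (∑ x, if x ∈ E then cylWeight (w₁ + w₂) L (fun _ => false) x else 0) =
        ∑ a : CylCfg w₁ L, cylWeight w₁ L (fun _ => false) a * ∑ b : CylCfg w₂ L,
          (if b ∈ {b : CylCfg w₂ L | (fun r => a.1 (Fin.last w₁, r)) = wallCol b ∧ joinCfg a b ∈ E}
            then cylWeight w₂ L (fun _ => false) b else 0) := by
      rw [num_eq_sum_sum hsum hwt (fun _ => false) E]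
      exact Finset.sum_congr rfl fun a _ => inner_mul _ _ _
    rw [eh, swap_sums E (fun a => cylWeight w₁ L (fun _ => false) a), swap_sums E (fun a => cylWeight w₁ L (τL τ) a),
      Finset.mul_sum]
    refine Finset.sum_le_sum fun b _ => ?_
    have key := num_div_le_of_lastWallMonotone hOne hwall hinv hprob hmono hL (τL τ)
      (lastWallMonotone_fibreL (L := L) hres hE b)
    rw [div_le_div_iff₀ (prod_colConst_pos (L := L) fun _ : Fin w₁ => false) (prod_colConst_pos _)] at key
    have hWb : 0 ≤ cylWeight w₂ L (fun _ => false) b := CylBunchStub.cylWeight_nonneg _ _ _ _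
    rw [← mul_assoc, mul_comm (_ / _) (cylWeight w₂ L (fun _ => false) b), mul_assoc]
    refine mul_le_mul_of_nonneg_left ?_ hWb
    rw [div_mul_eq_mul_div, div_le_iff₀ (prod_colConst_pos (L := L) fun _ : Fin w₁ => false), mul_comm]
    convert key using 4
  -- COMBINE
  have hNh : 0 ≤ ∑ x, if x ∈ E then cylWeight (w₁ + w₂) L (fun _ => false) x else 0 :=
    Finset.sum_nonneg fun x _ => by split_ifs; exacts [CylBunchStub.cylWeight_nonneg _ _ _ _, le_rfl]
  unfold cylProb
  rw [hZτ, hZh]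
  exact final_ineq (prod_colConst_pos _) (prod_colConst_pos _) (prod_colConst_pos (L := L) fun _ : Fin w₁ => false)
    (prod_colConst_pos (L := L) fun _ : Fin w₂ => false) hcard hNh step1 step2

end Summit.CriticalPhenomena.CardyFormulaZ2.Theorems.IKLinearTransport.PinnedDiagramExchange.WallDomination

end

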